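import Mathlib.Algebra.MvPolynomial.Equiv
import Mathlib.Algebra.Polynomial.Degree.TrailingDegree
import Mathlib.Algebra.Polynomial.Roots
import Mathlib.Data.Fintype.EquivFin
import HarnessLib

/-!
# Sparse polynomials are hit on a low-dimensional coordinate slice through any full-support
# point (Forbes–Shpilka–Volk 2018, §5.1: Lemma 32 with Lemma 31, as used in Cor. 34)

Topic `Barriers/ValiantsHypothesis` (the unconditional half of the algebraic natural-proofs
barrier: succinct hitting sets for RESTRICTED distinguisher classes, FSV Thm. 9).  The
combinatorial heart of FSV's succinct hitting set for SPARSE distinguishers (FSV §5.1,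
"the results in this section ... appl[y] to any class that has (possibly after shifting) small
support monomials"):

* FSV Lemma 32 (= Forbes 2015 / Gurjar–Korwar–Saxena–Thierauf 2016, three proofs in print): a
  polynomial `D` with at most `s` monomials, shifted by a FULL-SUPPORT vector `α` (all `αᵢ ≠ 0`),
  has a monomial of support `≤ log₂ s`;
* FSV Lemma 31: hence `D` does not vanish identically on the coordinate slice
  `α + 𝔽^T` for some `T` with `2^{#T} ≤ s` — which is what the (shifted, succinct)
  Shpilka–Volkovich generator exploits (FSV Cor. 34).

**What this file proves.** The HITTING FORM of the two lemmas combined, over any infinite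
integral domain `R` and any finite variable type `σ`:

  `exists_slice_hit_of_ne_zero` — if `D ≠ 0` and `α : σ → R` has `α i ≠ 0` for all `i`,
  there are a set `T` of coordinates with `2 ^ #T ≤ #supp D` and a point `x` agreeing with `α`
  outside `T` at which `D` does not vanish (`exists_slice_hit_of_card_support_le`: the same with
  a sparsity budget `#supp D ≤ s < 2 ^ k`, giving `#T < k`).

The proof is NOT one of the three printed ones (no trailing-monomial / Oliveira sparsity lemma):
a direct induction on the number of variables.  Split `D` along the first variable `x₀`,
`D = Σ_j d_j(x') x₀^j`; the monomials of `D` with `x₀`-degree `j` are in bijection with those of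
`d_j`, so the lowest and highest nonzero slices `d_{j₀}`, `d_{j₁}` satisfy
`#supp d_{j₀} + #supp d_{j₁} ≤ #supp D` when `j₀ < j₁`; recurse into the sparser one (a factor
`2` gained pays for putting `x₀` into `T`, and `x₀` is then chosen off the finitely many roots
of the nonzero univariate specialisation), while if `j₀ = j₁` the polynomial is `x₀^{j₀} d_{j₀}`
and `x₀ := α₀ ≠ 0` costs nothing.  Stated for `σ = Fin N` (`exists_slice_hit_fin`) and
transported to any finite `σ`.

Used by `Summits/ValiantsHypothesis/ValiantsHypothesis/Theorems/BarrierLeverSparsityWall.lean`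
(FSV Cor. 34 in the regime `d = n`: small circuits hit sparse distinguishers, so every equation
for `VP_n(n^b)`, `b ≥ 3`, has super-polynomially many monomials in `N = C(2n,n)`).

## References

* [ForbesShpilkaVolk2018] M. A. Forbes, A. Shpilka, B. L. Volk, *Succinct hitting sets and
  barriers to proving lower bounds for algebraic circuits*, Theory Comput. 14 (2018)
  (arXiv:1701.05328), §5.1: Lemma 31, Lemma 32, Cor. 34 (arXiv numbering).
* M. A. Forbes, *Deterministic divisibility testing via shifted partial derivatives*, FOCS 2015
  (the trailing-monomial form of Lemma 32).
* R. Gurjar, A. Korwar, N. Saxena, T. Thierauf, *Deterministic identity testing for sum of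
  read-once oblivious arithmetic branching programs*, Comput. Complexity 2016 (second proof).
-/

noncomputable section

namespace Literature.Barriers.ValiantsHypothesis

namespace FSV2018

open MvPolynomial Finset

variable {R : Type*} [CommRing R]

/-! ### Splitting the support along the first variable -/

/-- The monomials of `D ∈ R[x₀, x']` with `x₀`-degree `i` are in bijection with the monomials of
the `i`-th coefficient `d_i ∈ R[x']` of `D` viewed as a polynomial in `x₀` (`finSuccEquiv`):
the support of `d_i`, re-embedded by `m ↦ m.cons i`, lies in the support of `D`. [folklore] -/
private theorem map_support_coeff_finSuccEquiv_subset {N : ℕ} (D : MvPolynomial (Fin (N + 1)) R)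
    (i : ℕ) :
    ((Polynomial.coeff (finSuccEquiv R N D) i).support.map
        ⟨Finsupp.cons i, Finsupp.cons_right_injective i⟩) ⊆ D.support := by
  intro m hm
  rw [Finset.mem_map] at hm
  obtain ⟨m', hm', rfl⟩ := hm
  exact mem_support_coeff_finSuccEquiv.1 hm'

/-- Two distinct `x₀`-slices of `D` have disjointly embedded supports, so their monomial counts
add up to at most `#supp D`. [folklore] -/
private theorem card_support_coeff_add_le {N : ℕ} (D : MvPolynomial (Fin (N + 1)) R) {i j : ℕ}
    (hij : i ≠ j) :
    (Polynomial.coeff (finSuccEquiv R N D) i).support.card +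
        (Polynomial.coeff (finSuccEquiv R N D) j).support.card ≤ D.support.card := by
  classical
  set Si := (Polynomial.coeff (finSuccEquiv R N D) i).support.map
    ⟨Finsupp.cons i, Finsupp.cons_right_injective i⟩ with hSi
  set Sj := (Polynomial.coeff (finSuccEquiv R N D) j).support.map
    ⟨Finsupp.cons j, Finsupp.cons_right_injective j⟩ with hSj
  have hdisj : Disjoint Si Sj := by
    rw [Finset.disjoint_left]
    intro m hmi hmj
    rw [hSi, Finset.mem_map] at hmi
    rw [hSj, Finset.mem_map] at hmj
    obtain ⟨a, -, rfl⟩ := hmi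
    obtain ⟨b, -, hb⟩ := hmj
    have h0 := congrArg (fun f : Fin (N + 1) →₀ ℕ => f 0) hb
    simp only [Function.Embedding.coeFn_mk, Finsupp.cons_zero] at h0
    exact hij h0.symm
  calc (Polynomial.coeff (finSuccEquiv R N D) i).support.card +
        (Polynomial.coeff (finSuccEquiv R N D) j).support.card
      = Si.card + Sj.card := by rw [hSi, hSj, Finset.card_map, Finset.card_map]
    _ = (Si ∪ Sj).card := (Finset.card_union_of_disjoint hdisj).symm
    _ ≤ D.support.card := Finset.card_le_card (Finset.union_subset
        (map_support_coeff_finSuccEquiv_subset D i) (map_support_coeff_finSuccEquiv_subset D j))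

/-- One slice alone: `#supp d_i ≤ #supp D`. [folklore] -/
private theorem card_support_coeff_le {N : ℕ} (D : MvPolynomial (Fin (N + 1)) R) (i : ℕ) :
    (Polynomial.coeff (finSuccEquiv R N D) i).support.card ≤ D.support.card := by
  calc (Polynomial.coeff (finSuccEquiv R N D) i).support.card
      = ((Polynomial.coeff (finSuccEquiv R N D) i).support.map
          ⟨Finsupp.cons i, Finsupp.cons_right_injective i⟩).card := (Finset.card_map _).symm
    _ ≤ D.support.card := Finset.card_le_card (map_support_coeff_finSuccEquiv_subset D i)

/-- Renaming along an injection preserves the number of monomials. [folklore] -/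
private theorem card_support_rename_of_injective {σ τ : Type*} {f : σ → τ} (hf : Function.Injective f)
    (D : MvPolynomial σ R) : (rename f D).support.card = D.support.card := by
  classical
  rw [support_rename_of_injective hf,
    Finset.card_image_of_injective _ (Finsupp.mapDomain_injective hf)]

/-! ### The hitting lemma on `Fin N` variables -/

variable [IsDomain R] [Infinite R]

/-- A nonzero univariate polynomial over an infinite domain has a non-root. [folklore] -/
private theorem exists_polynomial_eval_ne_zero {q : Polynomial R} (hq : q ≠ 0) :
    ∃ t : R, Polynomial.eval t q ≠ 0 := by
  classical
  obtain ⟨t, ht⟩ := Infinite.exists_notMem_finset q.roots.toFinset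
  refine ⟨t, fun h => ht ?_⟩
  rw [Multiset.mem_toFinset, Polynomial.mem_roots hq]
  exact h

/-- **FSV Lemma 32 with Lemma 31, hitting form, `Fin N` variables.**  Over an infinite integral
domain: if `D ≠ 0` and `α` has no zero coordinate, then for some coordinate set `T` with
`2 ^ #T ≤ #supp D` the polynomial `D` is nonzero at a point that agrees with `α` outside `T`
("an `s`-sparse polynomial is hit on a full-support point perturbed in `≤ log₂ s` coordinates").
[cite: ForbesShpilkaVolk2018, Lemma 32 and Cor. 34 (arXiv numbering, §5.1)] -/
theorem exists_slice_hit_fin :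
    ∀ (N : ℕ) (D : MvPolynomial (Fin N) R), D ≠ 0 → ∀ α : Fin N → R, (∀ i, α i ≠ 0) →
      ∃ T : Finset (Fin N), 2 ^ T.card ≤ D.support.card ∧
        ∃ x : Fin N → R, (∀ i, i ∉ T → x i = α i) ∧ eval x D ≠ 0
  | 0, D, hD, α, _ => by
    refine ⟨∅, ?_, α, fun _ _ => rfl, ?_⟩
    · rw [Finset.card_empty, pow_zero, Nat.one_le_iff_ne_zero, Ne, Finset.card_eq_zero,
        MvPolynomial.support_eq_empty]
      exact hD
    · obtain ⟨c, rfl⟩ : ∃ c, D = C c := ⟨_, D.eq_C_of_isEmpty⟩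
      rwa [eval_C, Ne, ← C_eq_zero (σ := Fin 0)]
  | N + 1, D, hD, α, hα => by
    classical
    set p : Polynomial (MvPolynomial (Fin N) R) := finSuccEquiv R N D with hp
    have hp0 : p ≠ 0 := (EmbeddingLike.map_ne_zero_iff (f := finSuccEquiv R N)).2 hD
    set j₁ := p.natDegree with hj₁
    set j₀ := p.natTrailingDegree with hj₀
    have hd₁ : p.coeff j₁ ≠ 0 := Polynomial.leadingCoeff_ne_zero.2 hp0
    have hd₀ : p.coeff j₀ ≠ 0 := Polynomial.trailingCoeff_nonzero_iff_nonzero.2 hp0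
    -- choose the slice to recurse into
    obtain ⟨j, hdj, hcount⟩ : ∃ j : ℕ, p.coeff j ≠ 0 ∧
        (j₀ = j₁ ∨ 2 * (p.coeff j).support.card ≤ D.support.card) := by
      by_cases heq : j₀ = j₁
      · exact ⟨j₁, hd₁, Or.inl heq⟩
      · have hsum : (p.coeff j₀).support.card + (p.coeff j₁).support.card ≤ D.support.card :=
          card_support_coeff_add_le D heq
        by_cases hle : (p.coeff j₀).support.card ≤ (p.coeff j₁).support.card
        · exact ⟨j₀, hd₀, Or.inr (by omega)⟩
        · exact ⟨j₁, hd₁, Or.inr (by omega)⟩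
    -- induction hypothesis on the chosen slice, with the tail of `α`
    obtain ⟨T', hT', x', hx'α, hx'⟩ :=
      exists_slice_hit_fin N (p.coeff j) hdj (fun i => α i.succ) (fun i => hα i.succ)
    -- the univariate specialisation at `x'`
    set q : Polynomial R := p.map (eval x') with hq
    have hqj : q.coeff j ≠ 0 := by rw [hq, Polynomial.coeff_map]; exact hx'
    have hq0 : q ≠ 0 := fun h => hqj (by rw [h, Polynomial.coeff_zero])
    have hevalD : ∀ t : R, eval (Fin.cons t x' : Fin (N + 1) → R) D = q.eval t := fun t => by
      rw [hq, hp]; exact eval_eq_eval_mv_eval' x' t D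
    rcases hcount with heq | hcount
    · -- `p` is the single slice `x₀^{j₁} d_{j₁}`: keep `x₀ = α₀`
      have hjj : j = j₁ := by
        by_contra hne
        rcases Nat.lt_or_gt_of_ne hne with hlt | hgt
        · exact hdj (Polynomial.coeff_eq_zero_of_lt_natTrailingDegree (hlt.trans_eq heq.symm))
        · exact hdj (Polynomial.coeff_eq_zero_of_natDegree_lt hgt)
      refine ⟨T'.map (Fin.succEmb N), ?_, Fin.cons (α 0) x', ?_, ?_⟩
      · rw [Finset.card_map]; exact hT'.trans (card_support_coeff_le D j)
      · intro i hi
        refine Fin.cases ?_ (fun i' hi' => ?_) i hi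
        · intro; rfl
        · rw [Fin.cons_succ]
          refine hx'α i' fun h => hi' ?_
          exact Finset.mem_map.2 ⟨i', h, rfl⟩
      · rw [hevalD, Polynomial.eval_eq_sum_range, Finset.sum_eq_single j₁]
        · rw [← hjj]
          exact mul_ne_zero hqj (pow_ne_zero _ (hα 0))
        · intro i _ hi
          have hpi : p.coeff i = 0 := by
            rcases Nat.lt_or_gt_of_ne hi with hlt | hgt
            · exact Polynomial.coeff_eq_zero_of_lt_natTrailingDegree (hlt.trans_eq heq.symm)
            · exact Polynomial.coeff_eq_zero_of_natDegree_lt hgt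
          rw [hq, Polynomial.coeff_map, hpi, map_zero, zero_mul]
        · intro hnot
          have : q.natDegree < j₁ := by
            have := Finset.mem_range.not.1 hnot; omega
          rw [Polynomial.coeff_eq_zero_of_natDegree_lt this, zero_mul]
    · -- two slices: put `x₀` into `T` and choose it off the roots of `q`
      obtain ⟨t, ht⟩ := exists_polynomial_eval_ne_zero hq0
      refine ⟨insert 0 (T'.map (Fin.succEmb N)), ?_, Fin.cons t x', ?_, ?_⟩
      · have hnot : (0 : Fin (N + 1)) ∉ T'.map (Fin.succEmb N) := by
          intro h
          obtain ⟨i, -, hi⟩ := Finset.mem_map.1 h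
          exact Fin.succ_ne_zero i hi
        rw [Finset.card_insert_of_notMem hnot, Finset.card_map, pow_succ]
        calc 2 ^ T'.card * 2 ≤ (p.coeff j).support.card * 2 := Nat.mul_le_mul_right 2 hT'
          _ ≤ D.support.card := by omega
      · intro i hi
        refine Fin.cases ?_ (fun i' hi' => ?_) i hi
        · intro h; exact absurd (Finset.mem_insert_self _ _) h
        · rw [Fin.cons_succ]
          refine hx'α i' fun h => hi' (Finset.mem_insert_of_mem ?_)
          exact Finset.mem_map.2 ⟨i', h, rfl⟩
      · rw [hevalD]; exact ht

/-! ### Any finite variable type -/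

/-- **FSV Lemma 32 with Lemma 31, hitting form** (any finite set of variables).  Over an infinite
integral domain `R`: if `D ≠ 0` has at most `s` monomials (`#supp D ≤ s` — take `s = #supp D`)
and `α : σ → R` has `α i ≠ 0` for all `i`, then there are a coordinate set `T` with
`2 ^ #T ≤ #supp D` (so `#T ≤ log₂ s`) and a point `x` with `x i = α i` for `i ∉ T` and
`D(x) ≠ 0`: a sparse polynomial cannot vanish on the union of the `log₂ s`-dimensional coordinate
slices through a full-support point.
[cite: ForbesShpilkaVolk2018, Lemma 32 and Cor. 34 (arXiv numbering, §5.1)] -/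
theorem exists_slice_hit_of_ne_zero {σ : Type*} [Finite σ] (D : MvPolynomial σ R) (hD : D ≠ 0)
    (α : σ → R) (hα : ∀ i, α i ≠ 0) :
    ∃ T : Finset σ, 2 ^ T.card ≤ D.support.card ∧
      ∃ x : σ → R, (∀ i, i ∉ T → x i = α i) ∧ eval x D ≠ 0 := by
  classical
  cases nonempty_fintype σ
  set N := Fintype.card σ
  let e : σ ≃ Fin N := Fintype.equivFin σ
  have hD' : rename e D ≠ 0 := fun h =>
    hD (rename_injective _ e.injective (by rw [h, map_zero]))
  obtain ⟨T', hT', x', hx'α, hx'⟩ :=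
    exists_slice_hit_fin N (rename e D) hD' (α ∘ e.symm) (fun i => hα _)
  refine ⟨T'.map e.symm.toEmbedding, ?_, x' ∘ e, ?_, ?_⟩
  · rw [Finset.card_map, ← card_support_rename_of_injective e.injective D]; exact hT'
  · intro i hi
    have hi' : e i ∉ T' := fun h => hi (Finset.mem_map.2 ⟨e i, h, by simp⟩)
    simpa using hx'α (e i) hi'
  · rwa [eval_rename] at hx'

/-- The same with an explicit sparsity budget `s`: `#supp D ≤ s` and `2 ^ k > s` force a hitting
slice of fewer than `k` free coordinates. [cite: ForbesShpilkaVolk2018, Cor. 34 (arXiv numbering, §5.1)] -/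
theorem exists_slice_hit_of_card_support_le {σ : Type*} [Finite σ] (D : MvPolynomial σ R)
    (hD : D ≠ 0) {s k : ℕ} (hs : D.support.card ≤ s) (hk : s < 2 ^ k)
    (α : σ → R) (hα : ∀ i, α i ≠ 0) :
    ∃ T : Finset σ, T.card < k ∧
      ∃ x : σ → R, (∀ i, i ∉ T → x i = α i) ∧ eval x D ≠ 0 := by
  obtain ⟨T, hT, x, hxα, hx⟩ := exists_slice_hit_of_ne_zero D hD α hα
  refine ⟨T, ?_, x, hxα, hx⟩
  by_contra hle
  have : 2 ^ k ≤ 2 ^ T.card := Nat.pow_le_pow_right (by norm_num) (not_lt.1 hle)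
  omega

end FSV2018

end Literature.Barriers.ValiantsHypothesis

end
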